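import Literature.AlgebraicGeometry.Motives.PushforwardStructureSheaf
import Literature.AlgebraicGeometry.Morphisms.CechH1Refinement
import Mathlib.LinearAlgebra.TensorProduct.Basis
import HarnessLib

/-!
# Gluing in `Γ(·, 𝒪_X) ⊗_k M` over a proper geometrically integral `X`

Let `X` be a proper geometrically integral scheme over a field `k` (so `Γ(X, 𝒪_X) = k`,
Görtz–Wedhorn I, Prop. 12.66; in this tree `isIso_appTop_of_geometricallyIntegral` of
`Motives/PushforwardStructureSheaf`), `(V_a)_a` a finite family of opens covering `X` and `M` a
`k`-vector space. This file proves the gluing statement used in the Künneth computation of `Ȟ¹`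
on product coverings (`Motives/KunnethH1ProductCover`; Görtz–Wedhorn II, proof of Thm. 24.73 via
Cor. 22.110): elements `b_a ∈ Γ(V_a, 𝒪_X) ⊗_k M` which agree in `Γ(V_a ∩ V_{a'}, 𝒪_X) ⊗_k M`
all come from ONE element of `M`,

* `exists_eq_one_tmul_of_compatible` — `∃ m, ∀ a, b_a = 1 ⊗ m`.

Proof: a `k`-basis `(e_s)` of `M` identifies `R ⊗_k M` with the finitely supported functions
`s ↦ R` (Mathlib `TensorProduct.equivFinsuppOfBasisRight`), naturally in the `k`-module `R`
(`equivFinsuppOfBasisRight_rTensor`, the one lemma Mathlib lacks); the coordinates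
`(b_a)_s ∈ Γ(V_a)` glue (sheaf property) to global functions, which are constants `c_s ∈ k`
(`algebraMap_sectionsTop_bijective`), and `m = Σ_s c_s e_s`.

Also: `algebraMap_sectionsTop_bijective` — `k → Γ(X, 𝒪_X)` is bijective (from
`isIso_appTop_of_geometricallyIntegral`). Mathlib searched (pin): `Module.Basis.ofVectorSpace`,
`TensorProduct.equivFinsuppOfBasisRight` with `equivFinsuppOfBasisRight_apply_tmul_apply` (used;
its twin `equivFinsuppOfBasisLeft` is already used in `Motives/HodgeTensorHomSeparationProofs`).

## References

* U. Görtz, T. Wedhorn, *Algebraic Geometry I: Schemes*, 2nd ed. (2020): Prop. 12.66, p. 439.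
  [GortzWedhorn2020]
* U. Görtz, T. Wedhorn, *Algebraic Geometry II: Cohomology of Schemes* (2023): Cor. 22.110, p. 399;
  Cor. 24.63, p. 539; proof of Thm. 24.73, p. 550 (read via the held copy). [GortzWedhorn2023]
-/

universe u

open CategoryTheory CategoryTheory.Limits AlgebraicGeometry MonoidalCategory TensorProduct
open CartesianMonoidalCategory
open Literature.AlgebraicGeometry.Morphisms

noncomputable section

namespace Literature.AlgebraicGeometry.Motives

variable {k : Type u} [Field k]

/-! ### `Γ(X, 𝒪_X) = k` -/

/-- **`k → Γ(X, 𝒪_X)` is bijective for `X` proper and geometrically integral over `k`**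
(Görtz–Wedhorn I, Prop. 12.66; in this tree `isIso_appTop_of_geometricallyIntegral`, Görtz–Wedhorn
II, Cor. 24.63 over `Spec k`), for the `k`-algebra `Sections X.hom ⊤` of `Morphisms/CechH1`.
[cite: GortzWedhorn2020, Prop. 12.66 (p. 439)] -/
theorem algebraMap_sectionsTop_bijective (X : SchemeOver k) [IsProper X.hom]
    [GeometricallyIntegral X.hom] : Function.Bijective (algebraMap k (Sections X.hom ⊤)) := by
  haveI : IsIso X.hom.appTop := isIso_appTop_of_geometricallyIntegral X.hom
  have h1 : Function.Bijective X.hom.appTop := ConcreteCategory.bijective_of_isIso _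
  have h2 : Function.Bijective (Scheme.ΓSpecIso (.of k)).inv :=
    ConcreteCategory.bijective_of_isIso _
  have e : (algebraMap k (Sections X.hom ⊤) : k → Sections X.hom ⊤) =
      Sections.res X.hom (le_refl ⊤) ∘ X.hom.appTop ∘ (Scheme.ΓSpecIso (.of k)).inv := rfl
  rw [e]
  refine Function.Bijective.comp ?_ (h1.comp h2)
  refine Function.bijective_iff_has_inverse.mpr ⟨id, fun s => ?_, fun s => ?_⟩
  · exact Sections.res_self X.hom s
  · exact Sections.res_self X.hom s

/-- Hence every global function on `X` is a constant. [folklore] -/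
theorem exists_eq_algebraMap_sectionsTop (X : SchemeOver k) [IsProper X.hom]
    [GeometricallyIntegral X.hom] (g : Sections X.hom ⊤) : ∃ c : k, algebraMap k _ c = g :=
  (algebraMap_sectionsTop_bijective X).2 g

/-! ### Coordinates of `R ⊗_k M` in a basis of `M`: naturality in `R` -/

section Coordinates

variable {M : Type*} [AddCommGroup M] [Module k M] {ι : Type*} [DecidableEq ι]
  (bs : Module.Basis ι k M) {R R' : Type*} [AddCommGroup R] [Module k R] [AddCommGroup R']
  [Module k R']

/-- **Naturality in `R` of the coordinates `R ⊗_k M ≃ (ι →₀ R)`** (Mathlib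
`TensorProduct.equivFinsuppOfBasisRight`, `r ⊗ m ↦ (s ↦ (bs.repr m s) • r)`): for a `k`-linear
`ψ : R → R'`, the coordinates of `(ψ ⊗ id) T` are `ψ` of the coordinates of `T`. [folklore] -/
theorem equivFinsuppOfBasisRight_rTensor (ψ : R →ₗ[k] R') (T : R ⊗[k] M) (s : ι) :
    TensorProduct.equivFinsuppOfBasisRight bs (LinearMap.rTensor M ψ T) s =
      ψ (TensorProduct.equivFinsuppOfBasisRight bs T s) := by
  induction T using TensorProduct.induction_on with
  | zero => simp only [map_zero, Finsupp.coe_zero, Pi.zero_apply]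
  | tmul r m => rw [LinearMap.rTensor_tmul, TensorProduct.equivFinsuppOfBasisRight_apply_tmul_apply,
      TensorProduct.equivFinsuppOfBasisRight_apply_tmul_apply, map_smul]
  | add x y hx hy => simp only [map_add, Finsupp.coe_add, Pi.add_apply, hx, hy]

end Coordinates

/-! ### Gluing -/

variable (X : SchemeOver k)

/-- **Gluing in `Γ(·, 𝒪_X) ⊗_k M`.** Let `X` be proper and geometrically integral over `k`,
`(V_a)_a` a finite family of opens covering `X`, `M` a `k`-vector space and
`b_a ∈ Γ(V_a, 𝒪_X) ⊗_k M` elements whose images in `Γ(V_a ∩ V_{a'}, 𝒪_X) ⊗_k M` agree for all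
`a, a'`. Then there is `m ∈ M` with `b_a = 1 ⊗ m` for all `a` (coordinates in a basis of `M`
glue to global functions on `X`, which are constants since `Γ(X, 𝒪_X) = k`). [folklore] -/
theorem exists_eq_one_tmul_of_compatible [IsProper X.hom] [GeometricallyIntegral X.hom]
    {A : Type*} [Finite A] (V : A → X.left.Opens) (hVcov : ⨆ a, V a = ⊤)
    {M : Type*} [AddCommGroup M] [Module k M] (b : ∀ a, Sections X.hom (V a) ⊗[k] M)
    (hb : ∀ a a',
      LinearMap.rTensor M (Sections.res X.hom (inf_le_left : V a ⊓ V a' ≤ V a)).toLinearMap (b a) =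
        LinearMap.rTensor M (Sections.res X.hom (inf_le_right : V a ⊓ V a' ≤ V a')).toLinearMap
          (b a')) :
    ∃ m : M, ∀ a, b a = 1 ⊗ₜ m := by
  classical
  cases nonempty_fintype A
  let bs := Module.Basis.ofVectorSpace k M
  -- coordinates `f a s ∈ Γ(V_a)` of `b_a`
  set f : ∀ a, Module.Basis.ofVectorSpaceIndex k M →₀ Sections X.hom (V a) :=
    fun a => TensorProduct.equivFinsuppOfBasisRight bs (b a) with hf
  -- they agree on overlaps
  have hglue : ∀ s a a', Sections.res X.hom (inf_le_left : V a ⊓ V a' ≤ V a) (f a s) =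
      Sections.res X.hom (inf_le_right : V a ⊓ V a' ≤ V a') (f a' s) := by
    intro s a a'
    have h := congrArg (fun T => TensorProduct.equivFinsuppOfBasisRight bs T s) (hb a a')
    simpa only [hf, equivFinsuppOfBasisRight_rTensor, AlgHom.toLinearMap_apply] using h
  -- glue to global functions `g s`, which are constants `c s`
  choose g hg using fun s => Sections.exists_res_eq X.hom V (fun a => (le_top : V a ≤ ⊤))
    (by rw [hVcov]) (fun a => f a s) (hglue s)
  choose c hc using fun s => exists_eq_algebraMap_sectionsTop X (g s)
  -- finitely many `s` matter
  let F : Finset (Module.Basis.ofVectorSpaceIndex k M) := Finset.univ.biUnion fun a => (f a).support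
  have hF : ∀ s ∉ F, ∀ a, f a s = 0 := by
    intro s hs a
    by_contra h
    exact hs (Finset.mem_biUnion.mpr ⟨a, Finset.mem_univ a, Finsupp.mem_support_iff.mpr h⟩)
  refine ⟨∑ s ∈ F, c s • bs s, fun a => ?_⟩
  have hfa : ∀ s, f a s = c s • (1 : Sections X.hom (V a)) := by
    intro s
    rw [← hg s a, ← hc s, AlgHom.commutes, Algebra.algebraMap_eq_smul_one]
  -- compare coordinates
  apply (TensorProduct.equivFinsuppOfBasisRight (M := Sections X.hom (V a)) bs).injective
  ext s
  change f a s = TensorProduct.equivFinsuppOfBasisRight bs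
    ((1 : Sections X.hom (V a)) ⊗ₜ ∑ t ∈ F, c t • bs t) s
  rw [TensorProduct.equivFinsuppOfBasisRight_apply_tmul_apply, map_sum, Finsupp.finsetSum_apply]
  simp only [map_smul, Module.Basis.repr_self, Finsupp.smul_apply, Finsupp.single_apply, smul_eq_mul,
    mul_ite, mul_one, mul_zero, Finset.sum_ite_eq']
  split_ifs with hs
  · exact hfa s
  · rw [zero_smul]; exact hF s hs a

end Literature.AlgebraicGeometry.Motives

end
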